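import Literature.Barriers.CriticalPhenomena.LaceExpansionLatticeFTHigherDeriv
import Mathlib.Analysis.SpecialFunctions.Trigonometric.Bounds
import HarnessLib

/-!
# Coordinate slices of lattice Fourier transforms: reduction modulo `2π`, higher derivatives
# `(i∂_l)^j f̂ = (x_l^j f)^`, and the Hölder continuity of the top derivative

Barrier catalogue `Literature/Barriers/CriticalPhenomena/` (D-0021), third support file for the
discharge of `Hara2008_lemma17Pc` (`LaceExpansionXSpaceNorms.lean`: Hara 2008, Lemma 1.7 —
Lemma 1.9 in the journal numbering). Generic tools (no percolation input), all PROVED, over the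
lattice transform `latticeFT f k = Σ_x f(x) e^{-ik·x}` (`LaceExpansionXSpaceAsymptotics.lean`) and
its higher coordinate derivatives (`LaceExpansionLatticeFTHigherDeriv.lean`):

* reduction modulo `2π`: `HaraNorms.wrap t ∈ (-π, π]`, `HaraNorms.red k` (coordinatewise),
  `HaraNorms.omega k = |red k|` — the Euclidean distance of `k` to `2πℤ^d` — with
  `latticeFT f (red k) = latticeFT f k`, `omega = knorm` on the cube, `|wrap (k_i)| ≤ omega k`,
  and the transfer of the infrared lower bound from the cube to all of `ℝ^d`
  (`one_sub_re_latticeFT_ge_omega`);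
* over the coordinate derivatives `latticeFTDn f j m = ∂_j^m f̂ = (-i)^m (x_j^m f)^` of
  `LaceExpansionLatticeFTHigherDeriv.lean`: their `2πℤ^d`-periodicity in the form
  `∂_j^m f̂(red k) = ∂_j^m f̂(k)`, the evenness bound `‖∂_j f̂(k)‖ ≤ (Σ|x|²|f|) ω(k)` for ALL `k`
  (from `norm_latticeFTDn_one_le_abs`, periodised), real moments `Σ|x|^q|f|`, `Σ|x_l|^q|f|`
  from `Σ|f|` and `Σ|x|^p|f|` (`q ≤ p`), and the Hölder estimate
  `‖∂_l^M f̂(k[l ↦ s+u]) - ∂_l^M f̂(k[l ↦ s])‖ ≤ 2 |u|^θ Σ_x |x_l|^{M+θ}|f(x)|` — the form in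
  which "`Σ_x |x|^φ |Π(x)| < ∞` with `φ > ⌊φ⌋`" enters Lemma 1.7 (§4.1.4).

## References

* T. Hara, Ann. Probab. 36 (2008) 530–593 (arXiv:math-ph/0504021): §1.1 (Fourier conventions),
  §4.1.2 ((4.10)), §4.2 ((4.24): finiteness of `∂^m ĝ`, `∂^m Ĵ` for `m ≤ M`), §4.1.4.
-/

noncomputable section

namespace Literature.Barriers.CriticalPhenomena.HaraNorms

open Filter Literature.Probability.LatticeModels Literature.Probability.Percolation
open scoped Topology

variable {d : ℕ}

/-! ### Reduction modulo `2π` -/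

/-- `wrap t ∈ (-π, π]` is the representative of `t` modulo `2π`. [folklore] -/
def wrap (t : ℝ) : ℝ := toIocMod Real.two_pi_pos (-Real.pi) t

/-- `wrap t ∈ (-π, π]`. [folklore] -/
theorem wrap_mem_Ioc (t : ℝ) : wrap t ∈ Set.Ioc (-Real.pi) Real.pi := by
  have h := toIocMod_mem_Ioc Real.two_pi_pos (-Real.pi) t
  rwa [show -Real.pi + 2 * Real.pi = Real.pi by ring] at h

/-- `wrap t = t + 2πn` for some integer `n`. [folklore] -/
theorem exists_wrap_eq (t : ℝ) : ∃ n : ℤ, wrap t = t + n * (2 * Real.pi) := by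
  refine ⟨-toIocDiv Real.two_pi_pos (-Real.pi) t, ?_⟩
  have h := toIocMod_sub_self Real.two_pi_pos (-Real.pi) t
  rw [zsmul_eq_mul] at h
  rw [wrap]
  push_cast at h ⊢
  linarith

/-- `wrap t = t` on `(-π, π]`. [folklore] -/
theorem wrap_eq_self {t : ℝ} (ht : t ∈ Set.Ioc (-Real.pi) Real.pi) : wrap t = t := by
  rw [wrap, toIocMod_eq_self]
  rwa [show -Real.pi + 2 * Real.pi = Real.pi by ring]

/-- `|wrap t| ≤ π`. [folklore] -/
theorem abs_wrap_le_pi (t : ℝ) : |wrap t| ≤ Real.pi := by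
  have h := wrap_mem_Ioc t
  rw [abs_le]
  exact ⟨h.1.le, h.2⟩

/-- `|wrap t| ≤ |t|` (the representative in `(-π, π]` is the smallest in absolute value). [folklore] -/
theorem abs_wrap_le_abs (t : ℝ) : |wrap t| ≤ |t| := by
  obtain ⟨n, hn⟩ := exists_wrap_eq t
  have hw := wrap_mem_Ioc t
  rcases eq_or_ne n 0 with rfl | hn0
  · simp [hn]
  · -- `|t| = |wrap t - 2πn| ≥ 2π|n| - |wrap t| ≥ π ≥ |wrap t|`
    have h1 : (1 : ℝ) ≤ |(n : ℝ)| := by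
      rw [← Int.cast_abs]
      exact_mod_cast Int.one_le_abs hn0
    have ht : t = wrap t - n * (2 * Real.pi) := by linarith
    have hπ := Real.pi_pos
    have h2 : |(n : ℝ) * (2 * Real.pi)| ≥ 2 * Real.pi := by
      rw [abs_mul, abs_of_pos (by positivity : (0 : ℝ) < 2 * Real.pi)]
      nlinarith
    have h3 : |t| ≥ |(n : ℝ) * (2 * Real.pi)| - |wrap t| := by
      have := abs_sub_abs_le_abs_sub ((n : ℝ) * (2 * Real.pi)) (wrap t)
      rw [abs_sub_comm, ← ht] at this
      exact this
    have h4 := abs_wrap_le_pi t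
    linarith

/-- `|wrap t| = |t|` on `[-π, π]` (at `t = -π`, `wrap t = π`). [folklore] -/
theorem abs_wrap_eq_abs {t : ℝ} (ht : t ∈ Set.Icc (-Real.pi) Real.pi) : |wrap t| = |t| := by
  rcases eq_or_lt_of_le ht.1 with h | h
  · -- `t = -π`
    have hw : wrap t = Real.pi := by
      rw [wrap, toIocMod_eq_iff]
      refine ⟨⟨by linarith [Real.pi_pos], by linarith⟩, -1, ?_⟩
      rw [← h, neg_one_zsmul]; ring
    rw [hw, ← h, abs_neg]
  · rw [wrap_eq_self ⟨h, ht.2⟩]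

/-- The character does not see the reduction: `e^{-i (wrap t) m} = e^{-i t m}` for `m ∈ ℤ`. [folklore] -/
theorem wrap_mul_intCast_eq (t : ℝ) (m : ℤ) : ∃ n : ℤ, wrap t * m = t * m + (n * m : ℤ) * (2 * Real.pi) := by
  obtain ⟨n, hn⟩ := exists_wrap_eq t
  exact ⟨n, by rw [hn]; push_cast; ring⟩

/-- Coordinatewise reduction of `k ∈ ℝ^d` into `(-π, π]^d`. [folklore] -/
def red (k : Fin d → ℝ) : Fin d → ℝ := fun i => wrap (k i)

/-- `red k` lies in the cube `[-π, π]^d`. [folklore] -/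
theorem red_mem_cube (k : Fin d → ℝ) : red k ∈ cube d :=
  fun i _ => ⟨(wrap_mem_Ioc (k i)).1.le, (wrap_mem_Ioc (k i)).2⟩

/-- `e^{-i (red k)·x} = e^{-ik·x}` for `x ∈ ℤ^d`. [folklore] -/
theorem cexp_neg_I_kdot_red (k : Fin d → ℝ) (x : Site d) :
    Complex.exp (-(Complex.I * (kdot (red k) x : ℂ))) = Complex.exp (-(Complex.I * (kdot k x : ℂ))) := by
  have hn : ∀ i, ∃ n : ℤ, wrap (k i) = k i + n * (2 * Real.pi) := fun i => exists_wrap_eq (k i)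
  choose n hn using hn
  have hk : kdot (red k) x = kdot k x + (∑ i, n i * x i : ℤ) * (2 * Real.pi) := by
    simp only [kdot, red, hn]
    push_cast
    rw [Finset.sum_mul, ← Finset.sum_add_distrib]
    refine Finset.sum_congr rfl fun i _ => by ring
  set m : ℤ := ∑ i, n i * x i with hm
  rw [hk, Complex.ofReal_add, Complex.ofReal_mul, Complex.ofReal_intCast, mul_add, neg_add, Complex.exp_add]
  conv_rhs => rw [← mul_one (Complex.exp _)]
  congr 1
  rw [show -(Complex.I * ((m : ℂ) * ((2 * Real.pi : ℝ) : ℂ))) = ((-m : ℤ) : ℂ) * (2 * Real.pi * Complex.I) by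
    push_cast; ring]
  exact Complex.exp_int_mul_two_pi_mul_I _

/-- **`f̂` is `2πℤ^d`-periodic**: `f̂(red k) = f̂(k)`. [folklore] -/
theorem latticeFT_red (f : Site d → ℝ) (k : Fin d → ℝ) : latticeFT f (red k) = latticeFT f k := by
  unfold latticeFT
  exact tsum_congr fun x => by rw [cexp_neg_I_kdot_red]

/-- `∂_j f̂` is `2πℤ^d`-periodic as well. [folklore] -/
theorem latticeFTD1_red (f : Site d → ℝ) (j : Fin d) (k : Fin d → ℝ) :
    latticeFTD1 f j (red k) = latticeFTD1 f j k := by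
  unfold latticeFTD1
  exact tsum_congr fun x => by rw [cexp_neg_I_kdot_red]

/-- `ω(k) := |red k|`, the Euclidean distance from `k` to `2πℤ^d`. [folklore] -/
def omega (k : Fin d → ℝ) : ℝ := knorm (red k)

/-- `ω ≥ 0`. [folklore] -/
theorem omega_nonneg (k : Fin d → ℝ) : 0 ≤ omega k := knorm_nonneg _

/-- `ω(k)² = Σ_i wrap(k_i)²`. [folklore] -/
theorem omega_sq (k : Fin d → ℝ) : omega k ^ 2 = ∑ i, wrap (k i) ^ 2 := knorm_sq _

/-- `|wrap (k_i)| ≤ ω(k)`. [folklore] -/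
theorem abs_wrap_le_omega (k : Fin d → ℝ) (i : Fin d) : |wrap (k i)| ≤ omega k :=
  abs_apply_le_knorm (red k) i

/-- `ω(k) ≤ π √d`. [folklore] -/
theorem omega_le (k : Fin d → ℝ) : omega k ≤ Real.pi * Real.sqrt d := by
  have h : omega k ^ 2 ≤ (Real.pi * Real.sqrt d) ^ 2 := by
    rw [omega_sq, mul_pow, Real.sq_sqrt (Nat.cast_nonneg d)]
    calc ∑ i, wrap (k i) ^ 2 ≤ ∑ _i : Fin d, Real.pi ^ 2 := Finset.sum_le_sum fun i _ => by
          have := abs_wrap_le_pi (k i)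
          rw [← sq_abs]
          exact pow_le_pow_left₀ (abs_nonneg _) this 2
      _ = Real.pi ^ 2 * d := by rw [Finset.sum_const, Finset.card_univ, Fintype.card_fin]; ring
  exact (pow_le_pow_iff_left₀ (omega_nonneg k) (by positivity) two_ne_zero).1 h

/-- On the cube `ω(k) = |k|`. [folklore] -/
theorem omega_eq_knorm {k : Fin d → ℝ} (hk : k ∈ cube d) : omega k = knorm k := by
  rw [omega, knorm, knorm]
  congr 1
  refine Finset.sum_congr rfl fun i _ => ?_
  rw [red, ← sq_abs, abs_wrap_eq_abs (hk i (Set.mem_univ i)), sq_abs]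

/-- `ω(k) ≤ |k|` everywhere. [folklore] -/
theorem omega_le_knorm (k : Fin d → ℝ) : omega k ≤ knorm k := by
  rw [omega, knorm, knorm]
  refine Real.sqrt_le_sqrt (Finset.sum_le_sum fun i _ => ?_)
  rw [red, ← sq_abs, ← sq_abs (k i)]
  exact pow_le_pow_left₀ (abs_nonneg _) (abs_wrap_le_abs (k i)) 2

/-- **The infrared lower bound off the cube**: a bound `c₁ |k|²/d ≤ 1 - Re Ĵ(k)` on `[-π,π]^d`
gives `c₁ ω(k)²/d ≤ 1 - Re Ĵ(k)` for all `k` (periodicity).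
[cite: Hara2008, Prop. 1.2 (c₁|k|²/d ≤ Ĵ(0) - Ĵ(k)) with §1.1 (periodicity of f̂)] -/
theorem one_sub_re_latticeFT_ge_omega {J : Site d → ℝ} {c₁ : ℝ}
    (hlow : ∀ k ∈ cube d, c₁ * (∑ i, k i ^ 2) / d ≤ 1 - (latticeFT J k).re) (k : Fin d → ℝ) :
    c₁ * omega k ^ 2 / d ≤ 1 - (latticeFT J k).re := by
  rw [← latticeFT_red J k, omega_sq]
  exact hlow (red k) (red_mem_cube k)

/-! ### Periodicity of `∂_j^m f̂` and the evenness bound in terms of `ω` -/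

/-- `∂_j^m f̂` is `2πℤ^d`-periodic: `∂_j^m f̂(red k) = ∂_j^m f̂(k)`. [folklore] -/
theorem latticeFTDn_red (f : Site d → ℝ) (j : Fin d) (m : ℕ) (k : Fin d → ℝ) :
    latticeFTDn f j m (red k) = latticeFTDn f j m k := by
  rw [latticeFTDn, latticeFTDn, latticeFT_red]

/-- **The evenness bound, periodised**: for a `ℤ^d`-symmetric `f` with `Σ|x|²|f| < ∞`,
`‖∂_j f̂(k)‖ ≤ (Σ_x |x|²|f(x)|) |wrap(k_j)| ≤ (Σ_x |x|²|f(x)|) ω(k)` for ALL `k` (not only on the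
cube). [cite: Hara2008, (4.28) ("because Ĵ(k) is even in k_j … |∂Ĵ(k)| ≤ c|k|")] -/
theorem norm_latticeFTDn_one_le_omega {f : Site d → ℝ} (hfs : IsZdSymmetric f)
    (h0 : Summable fun x => |f x|) (h2 : Summable fun x => euclidNorm x ^ 2 * |f x|) (j : Fin d)
    (k : Fin d → ℝ) :
    ‖latticeFTDn f j 1 k‖ ≤ (∑' x, euclidNorm x ^ 2 * |f x|) * omega k := by
  rw [← latticeFTDn_red]
  refine (norm_latticeFTDn_one_le_abs hfs h0 h2 j (red k)).trans ?_
  exact mul_le_mul_of_nonneg_left (abs_wrap_le_omega k j) (tsum_nonneg fun x => by positivity)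

/-! ### Real moments -/

/-- `|x_l|^q ≤ |x|^q` (real exponent `q ≥ 0`). [folklore] -/
theorem abs_apply_rpow_le (x : Site d) (l : Fin d) {q : ℝ} (hq : 0 ≤ q) :
    |((x l : ℤ) : ℝ)| ^ q ≤ euclidNorm x ^ q :=
  Real.rpow_le_rpow (abs_nonneg _) (abs_apply_le_euclidNorm x l) hq

/-- A real moment `Σ |x|^q |f| < ∞` (`0 ≤ q ≤ p`) follows from `Σ|f| < ∞` and `Σ|x|^p|f| < ∞`.
[folklore] -/
theorem summable_rpow_mul_abs_of_le {f : Site d → ℝ} {p q : ℝ} (hq : 0 ≤ q) (hqp : q ≤ p)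
    (h0 : Summable fun x => |f x|) (hp : Summable fun x => euclidNorm x ^ p * |f x|) :
    Summable fun x => euclidNorm x ^ q * |f x| := by
  refine Summable.of_nonneg_of_le (fun x => mul_nonneg (Real.rpow_nonneg (euclidNorm_nonneg x) q) (abs_nonneg _))
    (fun x => ?_) (h0.add hp)
  have he := euclidNorm_nonneg x
  have hle : euclidNorm x ^ q ≤ 1 + euclidNorm x ^ p := by
    rcases le_or_gt (euclidNorm x) 1 with h1 | h1
    · calc euclidNorm x ^ q ≤ 1 := Real.rpow_le_one he h1 hq
        _ ≤ 1 + euclidNorm x ^ p := le_add_of_nonneg_right (Real.rpow_nonneg he p)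
    · calc euclidNorm x ^ q ≤ euclidNorm x ^ p := Real.rpow_le_rpow_of_exponent_le h1.le hqp
        _ ≤ 1 + euclidNorm x ^ p := le_add_of_nonneg_left zero_le_one
  calc euclidNorm x ^ q * |f x| ≤ (1 + euclidNorm x ^ p) * |f x| := mul_le_mul_of_nonneg_right hle (abs_nonneg _)
    _ = |f x| + euclidNorm x ^ p * |f x| := by ring

/-- The coordinate real moment `Σ_x |x_l|^q |f(x)| < ∞` from the Euclidean one. [folklore] -/
theorem summable_abs_apply_rpow_mul_abs {f : Site d → ℝ} (l : Fin d) {q : ℝ} (hq : 0 ≤ q)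
    (h : Summable fun x => euclidNorm x ^ q * |f x|) :
    Summable fun x => |((x l : ℤ) : ℝ)| ^ q * |f x| :=
  Summable.of_nonneg_of_le (fun _ => mul_nonneg (Real.rpow_nonneg (abs_nonneg _) q) (abs_nonneg _))
    (fun x => mul_le_mul_of_nonneg_right (abs_apply_rpow_le x l hq) (abs_nonneg _)) h

/-! ### Hölder continuity of the top derivative -/

/-- `‖e^{-ia} - 1‖ ≤ 2 |a|^θ` for real `a` and `0 ≤ θ ≤ 1` (from `≤ |a|` and `≤ 2`). [folklore] -/
theorem norm_cexp_neg_I_mul_sub_one_le (a : ℝ) {θ : ℝ} (hθ0 : 0 ≤ θ) (hθ1 : θ ≤ 1) :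
    ‖Complex.exp (-(Complex.I * (a : ℂ))) - 1‖ ≤ 2 * |a| ^ θ := by
  have hA : ‖Complex.exp (-(Complex.I * (a : ℂ))) - 1‖ ≤ |a| := by
    have h := Real.norm_exp_I_mul_ofReal_sub_one_le (x := -a)
    rw [Real.norm_eq_abs, abs_neg] at h
    have harg : -(Complex.I * (a : ℂ)) = Complex.I * ((-a : ℝ) : ℂ) := by push_cast; ring
    rwa [harg]
  have hB : ‖Complex.exp (-(Complex.I * (a : ℂ))) - 1‖ ≤ 2 := by
    refine (norm_sub_le _ _).trans ?_
    rw [Complex.norm_exp, norm_one]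
    simp only [Complex.neg_re, Complex.mul_re, Complex.I_re, Complex.ofReal_re, zero_mul, Complex.I_im,
      Complex.ofReal_im, mul_zero, sub_zero, neg_zero, Real.exp_zero]
    norm_num
  rcases le_or_gt 1 |a| with h1 | h1
  · calc ‖Complex.exp (-(Complex.I * (a : ℂ))) - 1‖ ≤ 2 := hB
      _ = 2 * 1 := by ring
      _ ≤ 2 * |a| ^ θ := by gcongr; exact Real.one_le_rpow h1 hθ0
  · calc ‖Complex.exp (-(Complex.I * (a : ℂ))) - 1‖ ≤ |a| := hA
      _ ≤ |a| ^ θ := by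
          rcases (abs_nonneg a).eq_or_lt with h0 | h0
          · rw [← h0]; exact Real.rpow_nonneg le_rfl θ
          · calc |a| = |a| ^ (1 : ℝ) := (Real.rpow_one _).symm
              _ ≤ |a| ^ θ := Real.rpow_le_rpow_of_exponent_ge h0 h1.le hθ1
      _ ≤ 2 * |a| ^ θ := by linarith [Real.rpow_nonneg (abs_nonneg a) θ]

/-- **Hölder continuity of `∂_l^M f̂` along the `l`-th coordinate**:
`‖∂_l^M f̂(k[l ↦ s+u]) - ∂_l^M f̂(k[l ↦ s])‖ ≤ 2 |u|^θ Σ_x |x_l|^{M+θ} |f(x)|` for `0 ≤ θ ≤ 1` —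
how the moment `Σ|x|^φ|Π| < ∞` with `φ = M + θ ∉ ℤ` is used.
[cite: Hara2008, Lemma 1.7 (hypothesis Σ|x|^φ|Π(x)| < ∞, φ > 1) and §4.1.4] -/
theorem norm_latticeFTDn_update_sub_le {f : Site d → ℝ} (l : Fin d) {M : ℕ} {θ : ℝ} (hθ0 : 0 ≤ θ) (hθ1 : θ ≤ 1)
    (hM : Summable fun x => |coordPow l M f x|)
    (hMθ : Summable fun x => |((x l : ℤ) : ℝ)| ^ ((M : ℝ) + θ) * |f x|) (k : Fin d → ℝ) (s u : ℝ) :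
    ‖latticeFTDn f l M (Function.update k l (s + u)) - latticeFTDn f l M (Function.update k l s)‖ ≤
      2 * |u| ^ θ * ∑' x, |((x l : ℤ) : ℝ)| ^ ((M : ℝ) + θ) * |f x| := by
  set e : ℝ → Site d → ℂ := fun t x => Complex.exp (-(Complex.I * (kdot (Function.update k l t) x : ℂ))) with he
  have hsum : ∀ t, Summable fun x => (coordPow l M f x : ℂ) * e t x := fun t => summable_latticeFT_term hM _
  have hdiff : latticeFT (coordPow l M f) (Function.update k l (s + u)) - latticeFT (coordPow l M f) (Function.update k l s) =
      ∑' x, (coordPow l M f x : ℂ) * e s x * (Complex.exp (-(Complex.I * ((u * ((x l : ℤ) : ℝ) : ℝ) : ℂ))) - 1) := by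
    unfold latticeFT
    rw [← Summable.tsum_sub (hsum (s + u)) (hsum s)]
    refine tsum_congr fun x => ?_
    have hk : kdot (Function.update k l (s + u)) x = kdot (Function.update k l s) x + u * ((x l : ℤ) : ℝ) := by
      rw [kdot_update, kdot_update]; ring
    simp only [he, hk]
    push_cast
    rw [show -(Complex.I * ((kdot (Function.update k l s) x : ℂ) + (u : ℂ) * ((x l : ℤ) : ℂ))) =
        -(Complex.I * (kdot (Function.update k l s) x : ℂ)) + -(Complex.I * ((u : ℂ) * ((x l : ℤ) : ℂ))) by ring,
      Complex.exp_add]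
    ring
  have hbound : ∀ x, ‖(coordPow l M f x : ℂ) * e s x * (Complex.exp (-(Complex.I * ((u * ((x l : ℤ) : ℝ) : ℝ) : ℂ))) - 1)‖ ≤
      2 * |u| ^ θ * (|((x l : ℤ) : ℝ)| ^ ((M : ℝ) + θ) * |f x|) := by
    intro x
    rw [norm_mul, norm_mul, Complex.norm_real, Real.norm_eq_abs, coordPow, abs_mul, abs_pow]
    have he1 : ‖e s x‖ = 1 := by rw [he]; exact norm_cexp_neg_I_kdot' _ _
    rw [he1, mul_one]
    have h3 := norm_cexp_neg_I_mul_sub_one_le (u * ((x l : ℤ) : ℝ)) hθ0 hθ1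
    rw [abs_mul, Real.mul_rpow (abs_nonneg u) (abs_nonneg _)] at h3
    have hxl : 0 ≤ |((x l : ℤ) : ℝ)| := abs_nonneg _
    calc |((x l : ℤ) : ℝ)| ^ M * |f x| * ‖Complex.exp (-(Complex.I * ((u * ((x l : ℤ) : ℝ) : ℝ) : ℂ))) - 1‖
        ≤ |((x l : ℤ) : ℝ)| ^ M * |f x| * (2 * (|u| ^ θ * |((x l : ℤ) : ℝ)| ^ θ)) := by gcongr
      _ = 2 * |u| ^ θ * ((|((x l : ℤ) : ℝ)| ^ (M : ℝ) * |((x l : ℤ) : ℝ)| ^ θ) * |f x|) := by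
          rw [Real.rpow_natCast]; ring
      _ = 2 * |u| ^ θ * (|((x l : ℤ) : ℝ)| ^ ((M : ℝ) + θ) * |f x|) := by
          rw [← Real.rpow_add_of_nonneg hxl (Nat.cast_nonneg M) hθ0]
  rw [latticeFTDn, latticeFTDn, ← mul_sub, norm_mul, norm_neg_I_pow, one_mul, hdiff]
  calc ‖∑' x, (coordPow l M f x : ℂ) * e s x * (Complex.exp (-(Complex.I * ((u * ((x l : ℤ) : ℝ) : ℝ) : ℂ))) - 1)‖
      ≤ ∑' x, 2 * |u| ^ θ * (|((x l : ℤ) : ℝ)| ^ ((M : ℝ) + θ) * |f x|) :=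
        tsum_of_norm_bounded ((hMθ.mul_left (2 * |u| ^ θ)).hasSum) hbound
    _ = 2 * |u| ^ θ * ∑' x, |((x l : ℤ) : ℝ)| ^ ((M : ℝ) + θ) * |f x| := tsum_mul_left
  where
  /-- `‖e^{-iq·x}‖ = 1` -/
  norm_cexp_neg_I_kdot' (q : Fin d → ℝ) (x : Site d) : ‖Complex.exp (-(Complex.I * (kdot q x : ℂ)))‖ = 1 := by
    rw [Complex.norm_exp]
    simp

end Literature.Barriers.CriticalPhenomena.HaraNorms
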